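import Summits.QuantumFields.BalabanUV.Beta.GAN24.DirichletVertexPullback
import Summits.QuantumFields.BalabanUV.Beta.GAN24.DirichletRingHessian
import Summits.QuantumFields.BalabanUV.Beta.GAN24.DirichletBoxCompression

/-!
# `BalabanUV.Beta.GAN24.DirichletVertexHessian` — binder row G-an2-4 / (CONV-C), road P2 PART IV, leaf L14 (the torus transfer), FILE B2:
# BINDER (A) NEAR A RE-ENTRANT VERTEX, ON THE TORUS — the distance-weighted Hessian of the Dirichlet solution on the dyadic neighbourhood
# `ρ ≤ 2^{J+3}` of every re-entrant vertex of a union of unit blocks in `d = 2` (unit b2b-balaban-gan24-p2, gen 26, v1)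

HONEST FRAMING (cell contract, verbatim): «discharging `BetaPertH` makes Bałaban's UV stability UNCONDITIONAL — a real constructive-QFT
result; it is NOT the continuum limit and NOT the Clay problem.»  SUPPLIER module under the T⁴-DAG sub-row `T4-U1a.S-NE2-D1-DIRICHLET°`
(holder: the t4-ne2-p1 lineage; owner wording R24 «the full rate L⁻¹ beyond boxes OPEN»).  Binder (A′) of the weighted socket
`DirichletBoxWeightedSockets.injected_le_of_weighted` (p234489) is the weighted interior Hessian `Σ_μ Σ_{x∈Ω′} w′(x)|(∂′ᴴ_μ∂′_μ v_w)(x)|² ≤ α′‖w‖²`.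
THIS FILE carries the model binder (A) at a vertex — `DirichletRingHessian.weighted_hessian_le` (p243612) — to the torus `Tor (fine n M)`,
`d = 2`, `Ω = blockReg n M S`: for every re-entrant vertex `(σ, b)` of `S` and the push-forward `hessW` along the chart `emb σ b` of the
model weight `offQ·ρ·𝟙[ρ ≤ 2^{J+3}]/n` (`ρ/n ≍` distance to the vertex in block units, on the dyadic neighbourhood `ρ ≤ 2^{J+3}`,
`20·2^J + 1 ≤ n − 1`), the weighted Hessian of `u_f = solExt f` charged to that neighbourhood is `≤ α₁·‖f‖²` with `α₁` depending on `ε`, `a′`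
only.  The COMPLEMENT of these neighbourhoods (flat faces, convex corners, checkerboard vertices, block interiors, the annuli
`2^{J+3} < ρ ≤ n` of re-entrant vertices) is NOT treated here (next files: per-vertex-type local `H²` in model coordinates).

## Contents ([folklore] finite sums on the tree's typed objects + the model END BY NAME; 0 sorry)

* §1 `hessW v K J`: the pushed-forward weight; nonnegativity; the EXCHANGE `Σ_x hessW_v(x)·F(x) = Σ_{Q_K} (offQ·w_J/n)·F∘emb`.
* §2 **`vertex_weighted_hessian_le`**: for `u` vanishing off `Ω` at a re-entrant `(σ, b)`, `2 ≤ n`, `2 ≤ M_ν`, `20·2^J + 1 ≤ n − 1`, `0 < ε`,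
  `1 < γ = π/3·(1−ε/2)`:
  `Σ_μ Σ_x hessW_{(σ,b)}(x)·|(∂ᴴ_μ∂_μ u)(x)|² ≤ 2(112 + 10⁹/(γ−1))·(‖∂₀u‖² + ‖∂₁u‖²) + (8/5 + 4π(112 + 10⁹/(γ−1))/(ε(2−γ)))·Σ_{x∈Ω}|(Δu)(x)|²`
  — the dictionary `(∂ᴴ_μ∂_μ u)(emb i j) = −n²·d_μ (Up u)(i,j)`, `d_μ (Uc u) = d_μ (Up u)` off the quadrant on the window, the model END at
  parameter `K = n − 1` with `hU := Uc_quadrant`, `hEq := lap_Uc_eq_Gc`, and the sum comparisons `Et_Uc_le`, `sqSum_Gc_le`.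
* §3 **`weighted_hessian_solExt_le`**: for `u = solExt n M a′ Ω f` and any finite family `V` of re-entrant vertices,
  `Σ_μ Σ_x (Σ_{v∈V} hessW_v(x))·|(∂ᴴ_μ∂_μ u)(x)|² ≤ |V|·α₁(ε, a′)·‖f‖²` (M-C `dirichlet_solExt_le`, `sum_normSq_LapS_solExt_le` BY NAME).

ABSOLUTE RULE (cell, verbatim): «No internally-minted statement may enter as a cited fact. Every hypothesis is either kernel-proved in
this package or a verbatim quotation of a PUBLISHED theorem with page reference. The manuscript(s) under audit are NOT citable for
their own disputed steps — they are the thing under adjudication; programme-internal (2001/route/tribunal) claims are never citable.»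
Nothing printed is a hypothesis.  NOT CLAIMED: (A)/(A′) on the WHOLE of `Ω` (the far/flat/convex/checkerboard parts are open), the
comparison `ω ≤ w′`, (Φ)/(Φ′), hence NOT the unconditional weighted END; NOT the vector layer, NE2, (CONV-C) as a whole, `BetaPertH`,
continuum, Clay.  Constants (`10⁹/(γ−1)`) are those of p243612, not optimised.  «not in print; our proof attempt».  HONEST DEPENDENCY:
continuum YM on T⁴ ⇐ BetaPertH ∧ nine spine estimates (0/9 proved); BetaPertH ⇐ (D1) ∧ (D4) ∧ CAP+tail; G-an2-4 gates asym, D1 and NE2/3/4.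
-/

noncomputable section

open scoped BigOperators ComplexConjugate Matrix
open Finset

namespace Summit.QuantumFields.BalabanUV.Beta.GAN24.DirichletVertexHessian

open Literature.MathematicalPhysics.QuantumFieldTheory.Balaban1983to89.B5Prop11Plancherel (Tor fine unitVec)
open Literature.MathematicalPhysics.QuantumFieldTheory.Balaban1983to89.B5Action121 (sdiff LapS)
open Literature.MathematicalPhysics.QuantumFieldTheory.Balaban1983to89.B5Prop11Lower (nsq nsq_nonneg)
open Summit.QuantumFields.BalabanUV.T4Continuum.ScalarAveragedPropagator (gammaPs gammaPs_pos dirichlet)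
open Summit.QuantumFields.BalabanUV.Beta.GAN24.DirichletBoxRegularity (Pdir)
open Summit.QuantumFields.BalabanUV.Beta.GAN24.DirichletBoxTrace (blockReg)
open Summit.QuantumFields.BalabanUV.Beta.GAN24.DirichletBoxCompression (solExt solExt_apply_of_not dirichlet_solExt_le sum_normSq_LapS_solExt_le)
open DirichletRingEnergies (lap Et sqSum Et_nonneg sqSum_nonneg)
open DirichletRingHessianIdentity (d1 d2 offQ offQ_nonneg offQ_le_one)
open DirichletRingHessianWindow (rho)
open DirichletRingLayerCake (wJ)
open DirichletRingHessian (weighted_hessian_le)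
open DirichletVertexChart
open DirichletVertexPullback

variable (n : ℕ) [NeZero n] (M : Fin 2 → ℕ) [hM : ∀ μ, NeZero (M μ)]

/-! ## §1 The push-forward of the dyadic distance weight -/

/-- `0 ≤ w_J`. [folklore] -/
theorem wJ_nonneg (J : ℕ) (i j : ℤ) : 0 ≤ wJ J i j := by
  unfold wJ
  split_ifs
  · have h := le_trans (DirichletRingCutoff.one_le_tIdx i) (le_max_left (DirichletRingCutoff.tIdx i) (DirichletRingCutoff.tIdx j))
    have : (0 : ℝ) ≤ (rho i j : ℝ) := by exact_mod_cast (le_trans zero_le_one h)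
    exact this
  · exact le_rfl

/-- the PUSHED-FORWARD HESSIAN WEIGHT of the vertex `v = (σ, b)` (model parameter `K`, dyadic depth `J`):
`hessW v K J x = Σ_{(s,t) ∈ [0,2K)²} [x = emb σ b (−K+s, −K+t)]·offQ·w_J(−K+s, −K+t)/n`, `w_J = ρ·𝟙[ρ ≤ 2^{J+3}]`. [folklore] -/
def hessW (v : (Fin 2 → Bool) × Tor M) (K J : ℕ) (x : Tor (fine n M)) : ℝ :=
  ∑ t ∈ range (2 * K), ∑ s ∈ range (2 * K),
    if x = emb n M v.1 v.2 (-(K : ℤ) + s) (-(K : ℤ) + t)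
      then offQ (-(K : ℤ) + s) (-(K : ℤ) + t) * wJ J (-(K : ℤ) + s) (-(K : ℤ) + t) / (n : ℝ) else 0

omit [NeZero n] hM in
/-- `0 ≤ hessW`. [folklore] -/
theorem hessW_nonneg (v : (Fin 2 → Bool) × Tor M) (K J : ℕ) (x : Tor (fine n M)) : 0 ≤ hessW n M v K J x := by
  refine sum_nonneg fun t _ => sum_nonneg fun s _ => ?_
  split_ifs
  · exact div_nonneg (mul_nonneg (offQ_nonneg _ _) (wJ_nonneg _ _ _)) (Nat.cast_nonneg _)
  · exact le_rfl

/-- **EXCHANGE OF SUMS**: `Σ_x hessW_v(x)·F(x) = Σ_{(s,t)} (offQ·w_J/n)(−K+s,−K+t)·F(emb σ b (−K+s) (−K+t))`. [folklore] -/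
theorem sum_hessW_mul (v : (Fin 2 → Bool) × Tor M) (K J : ℕ) (F : Tor (fine n M) → ℝ) :
    ∑ x, hessW n M v K J x * F x
      = ∑ t ∈ range (2 * K), ∑ s ∈ range (2 * K),
          offQ (-(K : ℤ) + s) (-(K : ℤ) + t) * wJ J (-(K : ℤ) + s) (-(K : ℤ) + t) / (n : ℝ)
            * F (emb n M v.1 v.2 (-(K : ℤ) + s) (-(K : ℤ) + t)) := by
  simp only [hessW, sum_mul]
  rw [sum_comm]
  refine sum_congr rfl fun t _ => ?_
  rw [sum_comm]
  refine sum_congr rfl fun s _ => ?_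
  simp only [ite_mul, zero_mul, sum_ite_eq', mem_univ, if_true]

/-! ## §2 The weighted Hessian charged to one re-entrant vertex -/

section Vertex

variable {S : Tor M → Prop} {σ : Fin 2 → Bool} {b : Tor M} {u : Tor (fine n M) → ℂ}

/-- the weighted second differences of the two pull-backs agree termwise on the window: for `(i, j) ∈ [−n, n)²`,
`offQ·(‖d1 (Up u)‖² + ‖d2 (Up u)‖²) = offQ·(‖d1 (Uc u)‖² + ‖d2 (Uc u)‖²)` at `(i, j)`. [folklore] -/
theorem offQ_hess_Up_eq (hu : ∀ x, ¬ blockReg n M S x → u x = 0) (hre : ReentrantAt M S σ b) {i j : ℤ}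
    (hi : -(n : ℤ) ≤ i) (hi' : i < n) (hj : -(n : ℤ) ≤ j) (hj' : j < n) :
    offQ i j * (‖d1 (Up n M σ b u) i j‖ ^ 2 + ‖d2 (Up n M σ b u) i j‖ ^ 2)
      = offQ i j * (‖d1 (Uc n M σ b u) i j‖ ^ 2 + ‖d2 (Uc n M σ b u) i j‖ ^ 2) := by
  by_cases hq : 0 ≤ i ∧ 0 ≤ j
  · rw [offQ, if_pos hq, zero_mul, zero_mul]
  · rw [d1_Uc_eq n M hu hre hi hi' hj hj' hq, d2_Uc_eq n M hu hre hi hi' hj hj' hq]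

/-- **THE WEIGHTED HESSIAN CHARGED TO ONE RE-ENTRANT VERTEX**: for `u` vanishing off `Ω` at a re-entrant `(σ, b)`, `2 ≤ n`, `2 ≤ M_ν`,
`20·2^J + 1 ≤ n − 1`, `0 < ε`, `1 < γ = π/3·(1−ε/2)`:
`Σ_μ Σ_x hessW_{(σ,b)}(x)·|(∂ᴴ_μ∂_μ u)(x)|² ≤ 2(112 + 10⁹/(γ−1))·(‖∂₀u‖² + ‖∂₁u‖²) + (8/5 + 4π(112 + 10⁹/(γ−1))/(ε(2−γ)))·Σ_{x∈Ω}|(Δu)(x)|²`.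
[folklore] -/
theorem vertex_weighted_hessian_le [DecidablePred S] (hu : ∀ x, ¬ blockReg n M S x → u x = 0) (hre : ReentrantAt M S σ b)
    (hn : 2 ≤ n) (hM0 : 2 ≤ M 0) (hM1 : 2 ≤ M 1) {J : ℕ} (hJ : 20 * 2 ^ J + 1 ≤ n - 1)
    {ε : ℝ} (hε : 0 < ε) (hγ : 1 < Real.pi / 3 * (1 - ε / 2)) :
    ∑ μ, ∑ x, hessW n M (σ, b) (n - 1) J x * ‖(Pdir (fine n M) (n : ℂ) μ *ᵥ u) x‖ ^ 2
      ≤ 2 * (112 + 10 ^ 9 / (Real.pi / 3 * (1 - ε / 2) - 1))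
          * (nsq (sdiff (fine n M) (n : ℂ) 0 *ᵥ u) + nsq (sdiff (fine n M) (n : ℂ) 1 *ᵥ u))
        + (8 / 5 + 4 * Real.pi * (112 + 10 ^ 9 / (Real.pi / 3 * (1 - ε / 2) - 1)) / (ε * (2 - Real.pi / 3 * (1 - ε / 2))))
          * ∑ x ∈ univ.filter (blockReg n M S), ‖(LapS (fine n M) (n : ℂ) *ᵥ u) x‖ ^ 2 := by
  -- abbreviations
  set K : ℕ := n - 1 with hK
  have hK1 : 1 ≤ K := by omega
  have hKn : K ≤ n := by omega
  set γ : ℝ := Real.pi / 3 * (1 - ε / 2) with hγdef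
  set U : ℤ → ℤ → ℂ := Uc n M σ b u with hUdef
  set E : ℝ := nsq (sdiff (fine n M) (n : ℂ) 0 *ᵥ u) + nsq (sdiff (fine n M) (n : ℂ) 1 *ᵥ u) with hE
  set B : ℝ := ∑ x ∈ univ.filter (blockReg n M S), ‖(LapS (fine n M) (n : ℂ) *ᵥ u) x‖ ^ 2 with hB
  set C : ℝ := 112 + 10 ^ 9 / (γ - 1) with hC
  have hπ3 := Real.pi_gt_three
  have hπ4 := Real.pi_lt_four
  have hε2 : ε < 2 := by
    by_contra h
    have : Real.pi / 3 * (1 - ε / 2) ≤ 0 := mul_nonpos_of_nonneg_of_nonpos (by positivity) (by linarith)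
    linarith
  have hγ2 : γ < 2 := by
    have : Real.pi / 3 * (1 - ε / 2) < Real.pi / 3 * 1 := mul_lt_mul_of_pos_left (by linarith) (by positivity)
    rw [hγdef]; linarith
  have hγ1 : 0 < γ - 1 := by rw [hγdef]; linarith
  have h2γ : 0 < 2 - γ := by linarith
  have hnR : (2 : ℝ) ≤ n := by exact_mod_cast hn
  have hn0 : (0 : ℝ) < n := by linarith
  have hKR : (K : ℝ) = n - 1 := by rw [hK]; push_cast [Nat.cast_sub (by omega : 1 ≤ n)]; ring
  have hK0 : (0 : ℝ) < K := by rw [hKR]; linarith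
  have hE0 : 0 ≤ E := add_nonneg (nsq_nonneg _) (nsq_nonneg _)
  have hB0 : 0 ≤ B := sum_nonneg fun _ _ => sq_nonneg _
  have hC0 : 0 < C := by positivity
  have hW0 : 2 * K + 2 ≤ n * M 0 := by have := Nat.mul_le_mul_left n hM0; omega
  have hW1 : 2 * K + 2 ≤ n * M 1 := by have := Nat.mul_le_mul_left n hM1; omega
  -- the model inputs at parameter `K`
  have hUq : ∀ s t : ℤ, 0 ≤ s → 0 ≤ t → U s t = 0 := Uc_quadrant n M σ b u
  have hEq : ∀ i j : ℤ, -(K : ℤ) ≤ i → i < K → -(K : ℤ) ≤ j → j < K → ¬(0 ≤ i ∧ 0 ≤ j) → lap U i j = Gc n M σ b u i j :=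
    fun i j hi hi' hj hj' hq => lap_Uc_eq_Gc n M hu hre i j (by omega) (by omega) (by omega) (by omega) hq
  have hEt : Et U K ≤ E / (n : ℝ) ^ 2 := Et_Uc_le n M hu hre hKn hW0 hW1
  have hSG : sqSum (fun i j => ‖Gc n M σ b u i j‖ ^ 2) K ≤ B / (n : ℝ) ^ 4 :=
    sqSum_Gc_le n M hre u hKn (by omega) (by omega)
  have hmodel := weighted_hessian_le U hJ (Gc n M σ b u) hUq hEq hε hγ
  -- Step 1: exchange of sums and the dictionary: LHS = n³·sqSum(offQ·w_J·(|d1 U|²+|d2 U|²)) K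
  have step1 : ∑ μ, ∑ x, hessW n M (σ, b) K J x * ‖(Pdir (fine n M) (n : ℂ) μ *ᵥ u) x‖ ^ 2
      = (n : ℝ) ^ 3 * sqSum (fun i j => offQ i j * wJ J i j * (‖d1 U i j‖ ^ 2 + ‖d2 U i j‖ ^ 2)) K := by
    rw [Fin.sum_univ_two, sum_hessW_mul, sum_hessW_mul, ← sum_add_distrib, sqSum, mul_sum]
    refine sum_congr rfl fun t ht => ?_
    rw [← sum_add_distrib, mul_sum]
    refine sum_congr rfl fun s hs => ?_
    simp only [mem_range] at ht hs
    set i : ℤ := -(K : ℤ) + s with hi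
    set j : ℤ := -(K : ℤ) + t with hj
    have hw := offQ_hess_Up_eq n M hu hre (i := i) (j := j) (by omega) (by omega) (by omega) (by omega)
    rw [Pdir_emb_fst, Pdir_emb_snd, norm_mul, norm_mul, norm_neg, norm_pow, Complex.norm_natCast, mul_pow, mul_pow, ← pow_mul,
      ← mul_add, ← mul_add, show 2 * 2 = 4 by rfl, hUdef]
    have e : offQ i j * wJ J i j / (n : ℝ) * ((n : ℝ) ^ 4 * (‖d1 (Up n M σ b u) i j‖ ^ 2 + ‖d2 (Up n M σ b u) i j‖ ^ 2))
        = (n : ℝ) ^ 3 * (wJ J i j * (offQ i j * (‖d1 (Up n M σ b u) i j‖ ^ 2 + ‖d2 (Up n M σ b u) i j‖ ^ 2))) := by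
      field_simp
    rw [e, hw]
    ring
  -- Step 2: the model END and the sum comparisons
  have hM : Et U K + (Real.pi / (2 * ε) * sqSum (fun i j => ‖Gc n M σ b u i j‖ ^ 2) K) * ((K : ℝ) + 3) ^ 2 / (2 - γ)
      ≤ (E + 2 * Real.pi / (ε * (2 - γ)) * B) / (n : ℝ) ^ 2 := by
    have hK3 : ((K : ℝ) + 3) ^ 2 ≤ 4 * (n : ℝ) ^ 2 := by rw [hKR]; nlinarith
    have hSG0 : 0 ≤ sqSum (fun i j => ‖Gc n M σ b u i j‖ ^ 2) K := sqSum_nonneg _ (fun _ _ => sq_nonneg _) _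
    calc Et U K + (Real.pi / (2 * ε) * sqSum (fun i j => ‖Gc n M σ b u i j‖ ^ 2) K) * ((K : ℝ) + 3) ^ 2 / (2 - γ)
        ≤ E / (n : ℝ) ^ 2 + (Real.pi / (2 * ε) * (B / (n : ℝ) ^ 4)) * (4 * (n : ℝ) ^ 2) / (2 - γ) := by
          gcongr
      _ = (E + 2 * Real.pi / (ε * (2 - γ)) * B) / (n : ℝ) ^ 2 := by
          field_simp
          ring
  have step2 : sqSum (fun i j => offQ i j * wJ J i j * (‖d1 U i j‖ ^ 2 + ‖d2 U i j‖ ^ 2)) K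
      ≤ 8 / 5 * K * (B / (n : ℝ) ^ 4) + C * ((E + 2 * Real.pi / (ε * (2 - γ)) * B) / (n : ℝ) ^ 2) / K := by
    refine hmodel.trans ?_
    rw [hC]
    gcongr
  -- Step 3: arithmetic
  have step3 : (n : ℝ) ^ 3 * (8 / 5 * K * (B / (n : ℝ) ^ 4) + C * ((E + 2 * Real.pi / (ε * (2 - γ)) * B) / (n : ℝ) ^ 2) / K)
      ≤ 2 * C * E + (8 / 5 + 4 * Real.pi * C / (ε * (2 - γ))) * B := by
    have hKn' : (K : ℝ) / n ≤ 1 := by rw [div_le_one hn0, hKR]; linarith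
    have hnK : (n : ℝ) / K ≤ 2 := by rw [div_le_iff₀ hK0, hKR]; linarith
    have e1 : (n : ℝ) ^ 3 * (8 / 5 * K * (B / (n : ℝ) ^ 4) + C * ((E + 2 * Real.pi / (ε * (2 - γ)) * B) / (n : ℝ) ^ 2) / K)
        = ((K : ℝ) / n) * (8 / 5 * B) + ((n : ℝ) / K) * (C * (E + 2 * Real.pi / (ε * (2 - γ)) * B)) := by
      field_simp
    rw [e1]
    have hX : 0 ≤ 8 / 5 * B := by positivity
    have hY : 0 ≤ C * (E + 2 * Real.pi / (ε * (2 - γ)) * B) := by positivity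
    calc (K : ℝ) / n * (8 / 5 * B) + (n : ℝ) / K * (C * (E + 2 * Real.pi / (ε * (2 - γ)) * B))
        ≤ 1 * (8 / 5 * B) + 2 * (C * (E + 2 * Real.pi / (ε * (2 - γ)) * B)) :=
          add_le_add (mul_le_mul_of_nonneg_right hKn' hX) (mul_le_mul_of_nonneg_right hnK hY)
      _ = 2 * C * E + (8 / 5 + 4 * Real.pi * C / (ε * (2 - γ))) * B := by
          field_simp
          ring
  calc _ = (n : ℝ) ^ 3 * sqSum (fun i j => offQ i j * wJ J i j * (‖d1 U i j‖ ^ 2 + ‖d2 U i j‖ ^ 2)) K := step1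
    _ ≤ (n : ℝ) ^ 3 * (8 / 5 * K * (B / (n : ℝ) ^ 4) + C * ((E + 2 * Real.pi / (ε * (2 - γ)) * B) / (n : ℝ) ^ 2) / K) :=
        mul_le_mul_of_nonneg_left step2 (by positivity)
    _ ≤ _ := step3

end Vertex

/-! ## §3 Binder (A) on the dyadic neighbourhoods of a family of re-entrant vertices -/

section Binder

variable (S : Tor M → Prop) [DecidablePred S] (a' : ℝ)

/-- the constant of binder (A) per vertex: `α₁ = 2(112 + 10⁹/(γ−1))·γ′⁻¹ + (8/5 + 4π(112 + 10⁹/(γ−1))/(ε(2−γ)))·2(1 + (a′γ′⁻¹)²)`. [folklore] -/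
def alphaV (ε a' : ℝ) : ℝ :=
  2 * (112 + 10 ^ 9 / (Real.pi / 3 * (1 - ε / 2) - 1)) * (gammaPs 2 a')⁻¹
    + (8 / 5 + 4 * Real.pi * (112 + 10 ^ 9 / (Real.pi / 3 * (1 - ε / 2) - 1)) / (ε * (2 - Real.pi / 3 * (1 - ε / 2))))
      * (2 * (1 + (a' * (gammaPs 2 a')⁻¹) ^ 2))

/-- **BINDER (A) ON THE DYADIC NEIGHBOURHOODS OF THE RE-ENTRANT VERTICES** (d = 2, any `S`, any finite family `V` of re-entrant
vertices of `S`): for `u = solExt n M a′ Ω f`, `Ω = blockReg n M S`, `2 ≤ n`, `2 ≤ M_ν`, `20·2^J + 1 ≤ n − 1`, `0 < a′`, `0 < ε`,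
`1 < γ = π/3·(1−ε/2)`: `Σ_μ Σ_x (Σ_{v∈V} hessW_v(x))·|(∂ᴴ_μ∂_μ u)(x)|² ≤ |V|·α₁·‖f‖²`. [folklore] -/
theorem weighted_hessian_solExt_le (V : Finset ((Fin 2 → Bool) × Tor M)) (hV : ∀ v ∈ V, ReentrantAt M S v.1 v.2)
    (hn : 2 ≤ n) (hM0 : 2 ≤ M 0) (hM1 : 2 ≤ M 1) {J : ℕ} (hJ : 20 * 2 ^ J + 1 ≤ n - 1) (ha' : 0 < a')
    {ε : ℝ} (hε : 0 < ε) (hγ : 1 < Real.pi / 3 * (1 - ε / 2)) (f : {y // blockReg n M S y} → ℂ) :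
    ∑ μ, ∑ x, (∑ v ∈ V, hessW n M v (n - 1) J x) * ‖(Pdir (fine n M) (n : ℂ) μ *ᵥ solExt n M a' (blockReg n M S) f) x‖ ^ 2
      ≤ V.card * alphaV ε a' * nsq f := by
  set u := solExt n M a' (blockReg n M S) f with hu
  have hu0 : ∀ x, ¬ blockReg n M S x → u x = 0 := fun x hx => solExt_apply_of_not n M a' _ f hx
  have hγp := (gammaPs_pos (d := 2) (a' := a')).1
  have hπ3 := Real.pi_gt_three
  have hε2 : ε < 2 := by
    by_contra h
    have : Real.pi / 3 * (1 - ε / 2) ≤ 0 := mul_nonpos_of_nonneg_of_nonpos (by positivity) (by linarith)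
    linarith
  have hγ1 : 0 < Real.pi / 3 * (1 - ε / 2) - 1 := by linarith
  have h2γ : 0 < 2 - Real.pi / 3 * (1 - ε / 2) := by
    have h1 : Real.pi / 3 * (1 - ε / 2) ≤ Real.pi / 3 * 1 := mul_le_mul_of_nonneg_left (by linarith) (by positivity)
    linarith [Real.pi_lt_four]
  -- the two global budgets
  have hE : nsq (sdiff (fine n M) (n : ℂ) 0 *ᵥ u) + nsq (sdiff (fine n M) (n : ℂ) 1 *ᵥ u) ≤ (gammaPs 2 a')⁻¹ * nsq f := by
    have h := dirichlet_solExt_le n M a' (blockReg n M S) ha' f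
    rw [dirichlet, Fin.sum_univ_two] at h
    exact h
  have hB : ∑ x ∈ univ.filter (blockReg n M S), ‖(LapS (fine n M) (n : ℂ) *ᵥ u) x‖ ^ 2 ≤ 2 * (1 + (a' * (gammaPs 2 a')⁻¹) ^ 2) * nsq f := by
    rw [Finset.sum_subtype (univ.filter (blockReg n M S)) (p := blockReg n M S) (fun x => by simp)
      (fun x => ‖(LapS (fine n M) (n : ℂ) *ᵥ u) x‖ ^ 2)]
    exact sum_normSq_LapS_solExt_le n M a' (blockReg n M S) ha' f
  have hf0 := nsq_nonneg f
  -- distribute the family sum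
  have hsplit : ∑ μ, ∑ x, (∑ v ∈ V, hessW n M v (n - 1) J x) * ‖(Pdir (fine n M) (n : ℂ) μ *ᵥ u) x‖ ^ 2
      = ∑ v ∈ V, ∑ μ, ∑ x, hessW n M v (n - 1) J x * ‖(Pdir (fine n M) (n : ℂ) μ *ᵥ u) x‖ ^ 2 := by
    calc ∑ μ, ∑ x, (∑ v ∈ V, hessW n M v (n - 1) J x) * ‖(Pdir (fine n M) (n : ℂ) μ *ᵥ u) x‖ ^ 2
        = ∑ μ, ∑ x, ∑ v ∈ V, hessW n M v (n - 1) J x * ‖(Pdir (fine n M) (n : ℂ) μ *ᵥ u) x‖ ^ 2 := by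
          simp only [sum_mul]
      _ = ∑ μ, ∑ v ∈ V, ∑ x, hessW n M v (n - 1) J x * ‖(Pdir (fine n M) (n : ℂ) μ *ᵥ u) x‖ ^ 2 :=
          sum_congr rfl fun μ _ => sum_comm
      _ = _ := sum_comm
  rw [hsplit]
  have hv : ∀ v ∈ V, ∑ μ, ∑ x, hessW n M v (n - 1) J x * ‖(Pdir (fine n M) (n : ℂ) μ *ᵥ u) x‖ ^ 2
      ≤ 2 * (112 + 10 ^ 9 / (Real.pi / 3 * (1 - ε / 2) - 1)) * ((gammaPs 2 a')⁻¹ * nsq f)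
        + (8 / 5 + 4 * Real.pi * (112 + 10 ^ 9 / (Real.pi / 3 * (1 - ε / 2) - 1)) / (ε * (2 - Real.pi / 3 * (1 - ε / 2))))
          * (2 * (1 + (a' * (gammaPs 2 a')⁻¹) ^ 2) * nsq f) := by
    intro v hvV
    have h := vertex_weighted_hessian_le n M (σ := v.1) (b := v.2) hu0 (hV v hvV) hn hM0 hM1 hJ hε hγ
    refine h.trans ?_
    gcongr
  calc ∑ v ∈ V, ∑ μ, ∑ x, hessW n M v (n - 1) J x * ‖(Pdir (fine n M) (n : ℂ) μ *ᵥ u) x‖ ^ 2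
      ≤ ∑ v ∈ V, (2 * (112 + 10 ^ 9 / (Real.pi / 3 * (1 - ε / 2) - 1)) * ((gammaPs 2 a')⁻¹ * nsq f)
        + (8 / 5 + 4 * Real.pi * (112 + 10 ^ 9 / (Real.pi / 3 * (1 - ε / 2) - 1)) / (ε * (2 - Real.pi / 3 * (1 - ε / 2))))
          * (2 * (1 + (a' * (gammaPs 2 a')⁻¹) ^ 2) * nsq f)) := sum_le_sum hv
    _ = V.card * alphaV ε a' * nsq f := by
        rw [sum_const, nsmul_eq_mul, alphaV]
        ring

end Binder

end Summit.QuantumFields.BalabanUV.Beta.GAN24.DirichletVertexHessian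

end
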